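import Mathlib
import Literature.RepresentationTheory.FiniteGroups.IsotypicProjector

/-!
# Permutation-module bounds for irreducible characters (helper for `LevelOneLink`)

Route `MatrixMultiplication/LevelGradedCohnUmans`, support item `stmt-MatrixMultiplication-14082`
(`Summit.MatrixMultiplication.MatrixMultiplication.Theses.LevelGradedCohnUmans.LevelOneLink`).
General finite-group facts (Frobenius reciprocity for permutation modules, in the elementary
form the level-one budget of `GL₂(𝔽_p)` needs), for a finite group `G` acting on a set `Ω`,
the permutation representation `P = Representation.ofMulAction ℂ G Ω` on `ℂ[Ω]`, and an
irreducible representation `ρ` of `G` on `V` with character `χ`: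

* `exists_fixed_of_character_eq_sum` — if `χ(g) = ∑ᵢ φᵢ(g • aᵢ)` is a sum of functions of single
  orbit points, then some point stabiliser `Stab(aᵢ)` has a non-zero fixed vector in `V`
  (otherwise every operator `∑_g φᵢ(g • aᵢ) ρ(g⁻¹)` vanishes, its trace gives
  `∑_g χ(g) χ(g⁻¹) = 0`, contradicting `char_orthonormal`);
* `orbitMap_intertwining`, `orbitMap_single_self_ne_zero`, `orbitMap_surjective` — a
  `Stab(a)`-fixed vector `w ≠ 0` gives the equivariant surjection `Φ : ℂ[Ω] ↠ V`,
  `Φ(e_u) = ∑_{g • a = u} ρ(g) w`;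
* `finrank_le_card_of_cover` — if moreover central elements (acting by scalars, Schur) move a
  finite set `R ⊆ Ω` onto the whole orbit of `a`, then `dim V ≤ |R|`;
* `finrank_le_finrank_range_isotypicProj` — `dim V ≤ rk P_χ` for the isotypic projector `P_χ`
  of any representation mapping equivariantly ONTO `V`;
* `sum_finrank_range_isotypicProj_le` — `∑_{χ ∈ S} rk P_χ ≤ dim W` for distinct irreducible
  characters (orthogonal idempotents, `IsotypicProjector.lean`).
-/

-- `Summit.<Summit>.<Problem>` is the tree's mandated summit-side namespace; for this
-- single-conjunct summit the two coincide, so the file silences `dupNamespace`.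
set_option linter.dupNamespace false

noncomputable section

open scoped BigOperators
open Module Literature.RepresentationTheory.FiniteGroups

namespace Summit.MatrixMultiplication.MatrixMultiplication.Theorems.LevelOneLink

variable {G : Type} [Group G] [Fintype G]

/-! ### Central elements act by scalars (Schur) -/

omit [Fintype G] in
/-- **Schur's lemma, central elements**: on an irreducible complex representation a central
group element acts by a scalar. [folklore] -/
theorem exists_apply_eq_smul_of_mem_center {V : Type} [AddCommGroup V] [Module ℂ V]
    [FiniteDimensional ℂ V] (ρ : Representation ℂ G V) [ρ.IsIrreducible] {z : G}
    (hz : z ∈ Submonoid.center G) : ∃ c : ℂ, ∀ v : V, ρ z v = c • v := by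
  obtain ⟨c, hc⟩ :=
    (Representation.IsIrreducible.algebraMap_intertwiningMap_bijective_of_isAlgClosed (ρ := ρ)).2
      (Representation.IntertwiningMap.centralMul ρ z hz)
  refine ⟨c, fun v => ?_⟩
  have h := congrArg (fun f : ρ.IntertwiningMap ρ => f v) hc
  simp only [Representation.IntertwiningMap.algebraMap_apply,
    Representation.IntertwiningMap.smul_apply, Representation.IntertwiningMap.coe_one,
    id_eq] at h
  rw [h]
  rfl

/-! ### A character in the span of one-orbit functions has a stabiliser-fixed vector -/

/-- **Fixed vectors from the Fourier support of a character.** Let `G` act on `Ω` and let `ρ` be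
an irreducible complex representation whose character is a finite sum `χ(g) = ∑ᵢ φᵢ(g • aᵢ)` of
functions of single orbit points. Then for some `i` the stabiliser of `aᵢ` has a non-zero fixed
vector in `ρ`. (If not, each `Tᵢ = ∑_g φᵢ(g • aᵢ) ρ(g⁻¹)` has `Stab(aᵢ)`-fixed, hence zero,
values; taking traces and summing over `i` gives `∑_g χ(g)χ(g⁻¹) = 0`, contradicting the
orthonormality `∑_g χ(g)χ(g⁻¹) = |G|`.) [folklore] -/
theorem exists_fixed_of_character_eq_sum {Ω : Type*} [MulAction G Ω]
    {V : Type} [AddCommGroup V] [Module ℂ V] [FiniteDimensional ℂ V]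
    (ρ : Representation ℂ G V) [ρ.IsIrreducible]
    {ι : Type*} [Fintype ι] (a : ι → Ω) (φ : ι → Ω → ℂ)
    (hχ : ∀ g : G, ρ.character g = ∑ i, φ i (g • a i)) :
    ∃ i, ∃ w : V, w ≠ 0 ∧ ∀ h : G, h • a i = a i → ρ h w = w := by
  classical
  by_contra H
  have H' : ∀ i (w : V), (∀ h : G, h • a i = a i → ρ h w = w) → w = 0 :=
    fun i w hw => by_contra fun hne => H ⟨i, w, hne, hw⟩
  -- (1) the operators `Tᵢ = ∑_g φᵢ(g • aᵢ) ρ(g⁻¹)` vanish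
  have hT : ∀ i, (∑ g : G, φ i (g • a i) • ρ g⁻¹ : V →ₗ[ℂ] V) = 0 := by
    intro i
    refine LinearMap.ext fun v => ?_
    rw [LinearMap.zero_apply]
    refine H' i _ fun h hh => ?_
    have hh' : h⁻¹ • a i = a i := by rw [inv_smul_eq_iff, hh]
    rw [LinearMap.sum_apply, map_sum]
    refine Fintype.sum_equiv (Equiv.mulRight h⁻¹) _ _ fun g => ?_
    simp only [Equiv.coe_mulRight, LinearMap.smul_apply, map_smul, mul_smul, hh', mul_inv_rev,
      inv_inv, map_mul, Module.End.mul_apply]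
  -- (2) traces: `∑_g φᵢ(g • aᵢ) χ(g⁻¹) = 0`
  have htr : ∀ i, ∑ g : G, φ i (g • a i) * ρ.character g⁻¹ = 0 := by
    intro i
    have h := congrArg (LinearMap.trace ℂ V) (hT i)
    rw [map_sum, map_zero] at h
    simpa only [map_smul, smul_eq_mul, Representation.character] using h
  -- (3) sum over `i`: `∑_g χ(g) χ(g⁻¹) = 0`
  have hsum : ∑ g : G, ρ.character g * ρ.character g⁻¹ = 0 := by
    calc ∑ g : G, ρ.character g * ρ.character g⁻¹
        = ∑ g : G, ∑ i, φ i (g • a i) * ρ.character g⁻¹ :=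
          Finset.sum_congr rfl fun g _ => by rw [hχ g, Finset.sum_mul]
      _ = ∑ i, ∑ g : G, φ i (g • a i) * ρ.character g⁻¹ := Finset.sum_comm
      _ = 0 := Finset.sum_eq_zero fun i _ => htr i
  -- (4) orthonormality
  haveI : Invertible (Nat.card G : ℂ) :=
    invertibleOfNonzero (Nat.cast_ne_zero.2 Nat.card_pos.ne')
  have horth := Representation.char_orthonormal ρ ρ
  rw [if_pos ⟨Representation.Equiv.refl _⟩, hsum, mul_zero] at horth
  exact zero_ne_one horth

/-! ### The orbit map `ℂ[Ω] → V` of a stabiliser-fixed vector -/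

section OrbitMap

variable {Ω : Type} [MulAction G Ω] [DecidableEq Ω]
variable {V : Type} [AddCommGroup V] [Module ℂ V]

/-- Reindexing: `∑_{g • a = x • u} ρ(g) w = ρ(x) ∑_{g • a = u} ρ(g) w`. [folklore] -/
theorem sum_ite_smul_eq (ρ : Representation ℂ G V) (a : Ω) (w : V) (x : G) (u : Ω) :
    (∑ g : G, if g • a = x • u then ρ g w else 0) =
      ρ x (∑ g : G, if g • a = u then ρ g w else 0) := by
  rw [map_sum]
  refine Fintype.sum_equiv (Equiv.mulLeft x⁻¹) _ _ fun g => ?_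
  simp only [Equiv.coe_mulLeft, mul_smul, inv_smul_eq_iff, map_mul, Module.End.mul_apply]
  split_ifs <;> simp

/-- **The orbit map is equivariant**: for a `Stab(a)`-fixed vector `w`, the linear map
`Φ : ℂ[Ω] → V`, `Φ(e_u) = ∑_{g • a = u} ρ(g) w`, intertwines the permutation representation
with `ρ`. [folklore] -/
theorem orbitMap_intertwining (ρ : Representation ℂ G V) (a : Ω) (w : V) (x : G) :
    ((MonoidAlgebra.basis Ω ℂ).constr ℂ
        (fun u : Ω => ∑ g : G, if g • a = u then ρ g w else 0)) ∘ₗ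
          Representation.ofMulAction ℂ G Ω x =
      ρ x ∘ₗ ((MonoidAlgebra.basis Ω ℂ).constr ℂ
        (fun u : Ω => ∑ g : G, if g • a = u then ρ g w else 0)) := by
  refine (MonoidAlgebra.basis Ω ℂ).ext fun u => ?_
  rw [LinearMap.comp_apply, LinearMap.comp_apply, MonoidAlgebra.basis_apply,
    Representation.ofMulAction_single, ← MonoidAlgebra.basis_apply, Basis.constr_basis,
    ← MonoidAlgebra.basis_apply, Basis.constr_basis]
  exact sum_ite_smul_eq ρ a w x u

/-- The orbit map at the base point: `Φ(e_a) = |Stab(a)| • w` when `w` is `Stab(a)`-fixed.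
[folklore] -/
theorem orbitMap_single_self (ρ : Representation ℂ G V) (a : Ω) {w : V}
    (hw : ∀ h : G, h • a = a → ρ h w = w) :
    (MonoidAlgebra.basis Ω ℂ).constr ℂ
        (fun u : Ω => ∑ g : G, if g • a = u then ρ g w else 0) (MonoidAlgebra.single a 1) =
      ((Finset.univ.filter fun g : G => g • a = a).card : ℂ) • w := by
  rw [← MonoidAlgebra.basis_apply, Basis.constr_basis]
  rw [← Finset.sum_filter, Finset.sum_congr rfl fun g hg => hw g (Finset.mem_filter.1 hg).2,
    Finset.sum_const, ← Nat.cast_smul_eq_nsmul ℂ]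

/-- The orbit map of a non-zero fixed vector is non-zero at `e_a`. [folklore] -/
theorem orbitMap_single_self_ne_zero (ρ : Representation ℂ G V) (a : Ω) {w : V} (hw0 : w ≠ 0)
    (hw : ∀ h : G, h • a = a → ρ h w = w) :
    (MonoidAlgebra.basis Ω ℂ).constr ℂ
        (fun u : Ω => ∑ g : G, if g • a = u then ρ g w else 0) (MonoidAlgebra.single a 1) ≠ 0 := by
  rw [orbitMap_single_self ρ a hw]
  refine smul_ne_zero (Nat.cast_ne_zero.2 ?_) hw0
  refine Finset.card_ne_zero.2 ⟨1, ?_⟩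
  simp

/-- **The orbit map onto an irreducible representation is surjective** (its range is a non-zero
subrepresentation). [folklore] -/
theorem orbitMap_surjective (ρ : Representation ℂ G V) [ρ.IsIrreducible] (a : Ω) {w : V}
    (hw0 : w ≠ 0) (hw : ∀ h : G, h • a = a → ρ h w = w) :
    Function.Surjective ((MonoidAlgebra.basis Ω ℂ).constr ℂ
        (fun u : Ω => ∑ g : G, if g • a = u then ρ g w else 0)) := by
  set Φ : (Representation.ofMulAction ℂ G Ω).IntertwiningMap ρ :=
    ⟨(MonoidAlgebra.basis Ω ℂ).constr ℂ (fun u : Ω => ∑ g : G, if g • a = u then ρ g w else 0),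
      fun x => orbitMap_intertwining ρ a w x⟩ with hΦ
  rcases eq_bot_or_eq_top Φ.range with h | h
  · exfalso
    have hmem : Φ (MonoidAlgebra.single a 1) ∈ Φ.range := ⟨_, rfl⟩
    rw [h] at hmem
    change _ ∈ (⊥ : Submodule ℂ V) at hmem
    rw [Submodule.mem_bot] at hmem
    exact orbitMap_single_self_ne_zero ρ a hw0 hw hmem
  · have hr : LinearMap.range Φ.toLinearMap = ⊤ := by
      have := congrArg Subrepresentation.toSubmodule h
      rwa [Representation.IntertwiningMap.range_toSubmodule] at this
    exact LinearMap.range_eq_top.1 hr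

/-- The range of the orbit map is spanned by the orbit sums `Φ(e_u)`, `u ∈ Ω`. [folklore] -/
theorem range_orbitMap_eq_span (ρ : Representation ℂ G V) (a : Ω) (w : V) :
    LinearMap.range ((MonoidAlgebra.basis Ω ℂ).constr ℂ
        (fun u : Ω => ∑ g : G, if g • a = u then ρ g w else 0)) =
      Submodule.span ℂ (Set.range fun u : Ω => ∑ g : G, if g • a = u then ρ g w else 0) := by
  rw [LinearMap.range_eq_map, ← (MonoidAlgebra.basis Ω ℂ).span_eq, Submodule.map_span,
    ← Set.range_comp]
  congr 1
  ext u
  simp only [Set.mem_range, Function.comp_apply, Basis.constr_basis]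

/-- **Degree bound by a line cover.** If `w ≠ 0` is `Stab(a)`-fixed in the irreducible `ρ`, and a
finite set `R ⊆ Ω` together with central elements of `G` covers the orbit of `a` (every `u` is
either outside the orbit or `u = z • r` with `r ∈ R`, `z` central), then `dim V ≤ |R|`: `V` is
spanned by the orbit sums `Φ(e_u)` (zero off the orbit), and `Φ(e_{z • r}) = ρ(z) Φ(e_r)` is a
scalar multiple of `Φ(e_r)` (Schur). [folklore] -/
theorem finrank_le_card_of_cover [FiniteDimensional ℂ V] (ρ : Representation ℂ G V)
    [ρ.IsIrreducible] (a : Ω) {w : V} (hw0 : w ≠ 0) (hw : ∀ h : G, h • a = a → ρ h w = w)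
    (R : Finset Ω)
    (hcover : ∀ u : Ω, (∀ g : G, g • a ≠ u) ∨ ∃ r ∈ R, ∃ z : G, z ∈ Submonoid.center G ∧ z • r = u) :
    finrank ℂ V ≤ R.card := by
  classical
  set v : Ω → V := fun u : Ω => ∑ g : G, if g • a = u then ρ g w else 0 with hv
  have hsurj := orbitMap_surjective ρ a hw0 hw
  have htop : (⊤ : Submodule ℂ V) ≤ Submodule.span ℂ (↑(R.image v) : Set V) := by
    rw [← LinearMap.range_eq_top.2 hsurj, range_orbitMap_eq_span, Submodule.span_le]
    rintro _ ⟨u, rfl⟩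
    rcases hcover u with hu | ⟨r, hr, z, hz, rfl⟩
    · -- `u` is outside the orbit of `a`: the orbit sum is empty
      have h0 : v u = 0 := by
        rw [hv]
        exact Finset.sum_eq_zero fun g _ => if_neg (hu g)
      change v u ∈ _
      rw [h0]
      exact Submodule.zero_mem _
    obtain ⟨c, hc⟩ := exists_apply_eq_smul_of_mem_center ρ hz
    have hzr : v (z • r) = c • v r := by
      rw [hv]
      dsimp only
      rw [sum_ite_smul_eq ρ a w z r, hc]
    change v (z • r) ∈ _
    rw [hzr]
    exact Submodule.smul_mem _ _ (Submodule.subset_span (Finset.mem_coe.2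
      (Finset.mem_image_of_mem v hr)))
  calc finrank ℂ V = finrank ℂ (⊤ : Submodule ℂ V) := (finrank_top ℂ V).symm
    _ ≤ finrank ℂ (Submodule.span ℂ (↑(R.image v) : Set V)) := Submodule.finrank_mono htop
    _ ≤ (R.image v).card := finrank_span_finset_le_card _
    _ ≤ R.card := Finset.card_image_le

end OrbitMap

/-! ### Multiplicity bounds via isotypic projectors -/

section Isotypic

variable {W : Type} [AddCommGroup W] [Module ℂ W] [FiniteDimensional ℂ W]
variable {V : Type} [AddCommGroup V] [Module ℂ V] [FiniteDimensional ℂ V]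

omit [FiniteDimensional ℂ W] [FiniteDimensional ℂ V] in
/-- Naturality of the isotypic projector along an intertwining map. [folklore] -/
theorem isotypicProj_comp_intertwining (P : Representation ℂ G W) (ρ : Representation ℂ G V)
    (Φ : P.IntertwiningMap ρ) (χ : G → ℂ) :
    Φ.toLinearMap ∘ₗ isotypicProj P χ = isotypicProj ρ χ ∘ₗ Φ.toLinearMap := by
  refine LinearMap.ext fun v => ?_
  simp only [LinearMap.comp_apply, isotypicProj_apply, map_sum, map_smul,
    Representation.IntertwiningMap.toLinearMap_apply, Φ.isIntertwining]

/-- **`dim V ≤ rk P_χ`**: if a representation `P` maps equivariantly onto the irreducible `ρ` of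
character `χ`, then `dim V` is at most the rank of the `χ`-isotypic projector of `P`
(`Φ ∘ P_χ = P_χ ∘ Φ = Φ` since `P_χ = 1` on `ρ`). [folklore] -/
theorem finrank_le_finrank_range_isotypicProj (P : Representation ℂ G W)
    (ρ : Representation ℂ G V) [ρ.IsIrreducible] (Φ : P.IntertwiningMap ρ)
    (hΦ : Function.Surjective Φ) {χ : G → ℂ} (hχ : ρ.character = χ) :
    finrank ℂ V ≤ finrank ℂ (LinearMap.range (isotypicProj P χ)) := by
  have hcomp : Φ.toLinearMap ∘ₗ isotypicProj P χ = Φ.toLinearMap := by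
    rw [isotypicProj_comp_intertwining, isotypicProj_eq_id_of_character_eq ρ hχ,
      LinearMap.id_comp]
  have hrange : LinearMap.range Φ.toLinearMap =
      Submodule.map Φ.toLinearMap (LinearMap.range (isotypicProj P χ)) := by
    conv_lhs => rw [← hcomp]
    rw [LinearMap.range_comp]
  have htop : LinearMap.range Φ.toLinearMap = ⊤ := LinearMap.range_eq_top.2 hΦ
  calc finrank ℂ V = finrank ℂ (⊤ : Submodule ℂ V) := (finrank_top ℂ V).symm
    _ = finrank ℂ (Submodule.map Φ.toLinearMap (LinearMap.range (isotypicProj P χ))) := by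
        rw [← htop, hrange]
    _ ≤ finrank ℂ (LinearMap.range (isotypicProj P χ)) := Submodule.finrank_map_le _ _

/-- **`∑_{χ ∈ S} rk P_χ ≤ dim W`** for a finite set `S` of (distinct) irreducible characters: the
`P_χ` are pairwise orthogonal idempotents, so `∑_{χ ∈ S} P_χ` is an idempotent of trace
`∑ rk P_χ`, i.e. of that rank. [folklore] -/
theorem sum_finrank_range_isotypicProj_le (P : Representation ℂ G W) (S : Finset (G → ℂ))
    (hS : ∀ χ ∈ S, IsIrrChar G χ) :
    ∑ χ ∈ S, finrank ℂ (LinearMap.range (isotypicProj P χ)) ≤ finrank ℂ W := by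
  classical
  -- the sum of the projectors is idempotent
  have hidem : IsIdempotentElem (∑ χ ∈ S, isotypicProj P χ) := by
    change (∑ χ ∈ S, isotypicProj P χ) * (∑ χ ∈ S, isotypicProj P χ) = ∑ χ ∈ S, isotypicProj P χ
    rw [Finset.sum_mul_sum]
    refine Finset.sum_congr rfl fun χ hχ => ?_
    rw [Finset.sum_eq_single χ]
    · rw [Module.End.mul_eq_comp, isotypicProj_comp_self P (hS χ hχ)]
    · intro χ' hχ' hne
      rw [Module.End.mul_eq_comp, isotypicProj_comp_of_ne P (hS χ hχ) (hS χ' hχ') (Ne.symm hne)]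
    · exact fun h => absurd hχ h
  have hidem' : ∀ χ ∈ S, IsIdempotentElem (isotypicProj P χ) := fun χ hχ => by
    change isotypicProj P χ * isotypicProj P χ = isotypicProj P χ
    rw [Module.End.mul_eq_comp, isotypicProj_comp_self P (hS χ hχ)]
  -- traces
  have htr : (LinearMap.trace ℂ W) (∑ χ ∈ S, isotypicProj P χ) =
      ((∑ χ ∈ S, finrank ℂ (LinearMap.range (isotypicProj P χ)) : ℕ) : ℂ) := by
    rw [map_sum, Nat.cast_sum]
    exact Finset.sum_congr rfl fun χ hχ =>
      (LinearMap.IsIdempotentElem.isProj_range _ (hidem' χ hχ)).trace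
  have htr' : (LinearMap.trace ℂ W) (∑ χ ∈ S, isotypicProj P χ) =
      (finrank ℂ (LinearMap.range (∑ χ ∈ S, isotypicProj P χ)) : ℂ) :=
    (LinearMap.IsIdempotentElem.isProj_range _ hidem).trace
  have heq : ∑ χ ∈ S, finrank ℂ (LinearMap.range (isotypicProj P χ)) =
      finrank ℂ (LinearMap.range (∑ χ ∈ S, isotypicProj P χ)) :=
    Nat.cast_injective (htr.symm.trans htr')
  rw [heq]
  exact Submodule.finrank_le _

end Isotypic

end Summit.MatrixMultiplication.MatrixMultiplication.Theorems.LevelOneLink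

end
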